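import Literature.Dynamics.SymbolicDynamics.DistortionOperator
import Mathlib.Tactic.Linarith
import Mathlib.Tactic.Ring
import HarnessLib

/-!
# The distortion `d_A(X)` of a subshift of finite type is of finite type

Gangloff–Sablik §5.4.2: "Denoting `r` the rank of the SFT `X`, `d_A(X)` can be defined by
imposing that, considering the intersection of a set of `r` contiguous curves with `r`
consecutive columns, the corresponding `r`-block is not a forbidden pattern in `X`. Because the
gap between two contiguous curves is bounded, `d_A(X)` is defined by a finite set of forbidden
patterns. Then this is a SFT."

Formally (`isSFT_distortion`): if `X = X(Ω, P)` is of finite type in the window form `IsSFT`,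
with `Ω ⊆ [-D, D]²`, then `d_A(X) = X(Ω', P')` for the box `Ω' = [-R, R]²`, `R = 3D + 1`, and
`P'` = the `Ω'`-patterns occurring in configurations of `d_A(X)`. The point is LOCALITY of the
curve structure (`curve_agree`): if two configurations obeying the rules of `Δ` agree on the
boxes of radius `R` around `→`-cells `c`, `c'`, then following `a` columns and `b` curves from
`c` and from `c'` leads to the same relative position whenever `|a| + 2|b| + 1 ≤ R` (a curve
moves by at most one row per column, contiguous curves are at most two rows apart, and each step
reads one cell adjacent to the current one). Hence a configuration all of whose `R`-boxes occur
in `d_A(X)` obeys the rules of `Δ` (they involve adjacent cells only) and its pseudo-projection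
has all its `Ω`-windows among those of pseudo-projections of members of `d_A(X)`, i.e. in `P`.

## References

* S. Gangloff, M. Sablik, *Quantified block gluing for multidimensional subshifts of finite type:
  aperiodicity and entropy*, J. Anal. Math. 144 (2021) 21–118, §5.4.2 (arXiv:1706.01627, p. 15).
-/

namespace Literature.Dynamics.SymbolicDynamics.Distortion

open Set Function
open _root_.SymbolicDynamics.FullShift

variable {A : Type*} {z z' : ℤ × ℤ → Option A}

/-- [cite: GangloffSablik2021, §5.4.1 (arXiv numbering)] -/
@[simp] theorem succPerm_inv_apply (hz : IsDelta z) (c : RC z) :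
    (succPerm hz)⁻¹ c = predFun hz c := rfl

/-- [cite: GangloffSablik2021, §5.4.1 (arXiv numbering)] -/
@[simp] theorem nxtPerm_inv_apply (hz : IsDelta z) (c : RC z) :
    (nxtPerm hz)⁻¹ c = prvFun hz c := rfl

/-! ### Locality of the curve structure -/

section Locality

variable (hz : IsDelta z) (hz' : IsDelta z') (c : RC z) (c' : RC z') (R : ℤ)
  (hag : ∀ p : ℤ × ℤ, |p.1 - c.1.1| ≤ R → |p.2 - c.1.2| ≤ R → z p = z' (p - c.1 + c'.1))

/-- One curve up from corresponding cells reads corresponding cells. [cite: GangloffSablik2021, §5.4.2 (arXiv numbering)] -/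
theorem nxtFun_agree (e : RC z) (e' : RC z') (he : e'.1 = e.1 - c.1 + c'.1)
    (h : z (e.1.1, e.1.2 + 1) = z' (e'.1.1, e'.1.2 + 1)) :
    (nxtFun hz' e').1 = (nxtFun hz e).1 - c.1 + c'.1 := by
  have he1 : e'.1.1 = e.1.1 - c.1.1 + c'.1.1 := by rw [he]; rfl
  have he2 : e'.1.2 = e.1.2 - c.1.2 + c'.1.2 := by rw [he]; rfl
  by_cases hn : z (e.1.1, e.1.2 + 1) = none
  · rw [nxtFun_val_of_eq_none hz e hn, nxtFun_val_of_eq_none hz' e' (h ▸ hn), he1, he2]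
    exact Prod.ext (by simp) (by simp only [Prod.snd_add, Prod.snd_sub]; ring)
  · rw [nxtFun_val_of_ne_none hz e hn, nxtFun_val_of_ne_none hz' e' (h ▸ hn), he1, he2]
    exact Prod.ext (by simp) (by simp only [Prod.snd_add, Prod.snd_sub]; ring)

/-- One curve down from corresponding cells reads corresponding cells. [cite: GangloffSablik2021, §5.4.2 (arXiv numbering)] -/
theorem prvFun_agree (e : RC z) (e' : RC z') (he : e'.1 = e.1 - c.1 + c'.1)
    (h : z (e.1.1, e.1.2 - 1) = z' (e'.1.1, e'.1.2 - 1)) :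
    (prvFun hz' e').1 = (prvFun hz e).1 - c.1 + c'.1 := by
  have he1 : e'.1.1 = e.1.1 - c.1.1 + c'.1.1 := by rw [he]; rfl
  have he2 : e'.1.2 = e.1.2 - c.1.2 + c'.1.2 := by rw [he]; rfl
  by_cases hn : z (e.1.1, e.1.2 - 1) = none
  · have hv : (prvFun hz e).1 = (e.1.1, e.1.2 - 1 - 1) := by unfold prvFun; rw [dif_pos hn]
    have hv' : (prvFun hz' e').1 = (e'.1.1, e'.1.2 - 1 - 1) := by
      unfold prvFun; rw [dif_pos (h ▸ hn)]
    rw [hv, hv', he1, he2]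
    exact Prod.ext (by simp) (by simp only [Prod.snd_add, Prod.snd_sub]; ring)
  · have hv : (prvFun hz e).1 = (e.1.1, e.1.2 - 1) := by unfold prvFun; rw [dif_neg hn]
    have hv' : (prvFun hz' e').1 = (e'.1.1, e'.1.2 - 1) := by
      unfold prvFun; rw [dif_neg (h ▸ hn)]
    rw [hv, hv', he1, he2]
    exact Prod.ext (by simp) (by simp only [Prod.snd_add, Prod.snd_sub]; ring)

/-- One column right from corresponding cells reads corresponding cells. [cite: GangloffSablik2021, §5.4.2 (arXiv numbering)] -/
theorem succFun_agree (e : RC z) (e' : RC z') (he : e'.1 = e.1 - c.1 + c'.1)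
    (h : z (e.1.1 + 1, e.1.2) = z' (e'.1.1 + 1, e'.1.2)) :
    (succFun hz' e').1 = (succFun hz e).1 - c.1 + c'.1 := by
  have he1 : e'.1.1 = e.1.1 - c.1.1 + c'.1.1 := by rw [he]; rfl
  have he2 : e'.1.2 = e.1.2 - c.1.2 + c'.1.2 := by rw [he]; rfl
  by_cases hn : z (e.1.1 + 1, e.1.2) = none
  · rw [succFun_val_of_eq_none hz e hn, succFun_val_of_eq_none hz' e' (h ▸ hn), he1, he2]
    exact Prod.ext (by simp only [Prod.fst_add, Prod.fst_sub]; ring)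
      (by simp only [Prod.snd_add, Prod.snd_sub]; ring)
  · rw [succFun_val_of_ne_none hz e hn, succFun_val_of_ne_none hz' e' (h ▸ hn), he1, he2]
    exact Prod.ext (by simp only [Prod.fst_add, Prod.fst_sub]; ring)
      (by simp only [Prod.snd_add, Prod.snd_sub])

/-- One column left from corresponding cells reads corresponding cells. [cite: GangloffSablik2021, §5.4.2 (arXiv numbering)] -/
theorem predFun_agree (e : RC z) (e' : RC z') (he : e'.1 = e.1 - c.1 + c'.1)
    (h : z (e.1.1 - 1, e.1.2) = z' (e'.1.1 - 1, e'.1.2)) :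
    (predFun hz' e').1 = (predFun hz e).1 - c.1 + c'.1 := by
  have he1 : e'.1.1 = e.1.1 - c.1.1 + c'.1.1 := by rw [he]; rfl
  have he2 : e'.1.2 = e.1.2 - c.1.2 + c'.1.2 := by rw [he]; rfl
  by_cases hn : z (e.1.1 - 1, e.1.2) = none
  · have hv : (predFun hz e).1 = (e.1.1 - 1, e.1.2 + 1) := by unfold predFun; rw [dif_pos hn]
    have hv' : (predFun hz' e').1 = (e'.1.1 - 1, e'.1.2 + 1) := by
      unfold predFun; rw [dif_pos (h ▸ hn)]
    rw [hv, hv', he1, he2]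
    exact Prod.ext (by simp only [Prod.fst_add, Prod.fst_sub]; ring)
      (by simp only [Prod.snd_add, Prod.snd_sub]; ring)
  · have hv : (predFun hz e).1 = (e.1.1 - 1, e.1.2) := by unfold predFun; rw [dif_neg hn]
    have hv' : (predFun hz' e').1 = (e'.1.1 - 1, e'.1.2) := by
      unfold predFun; rw [dif_neg (h ▸ hn)]
    rw [hv, hv', he1, he2]
    exact Prod.ext (by simp only [Prod.fst_add, Prod.fst_sub]; ring)
      (by simp only [Prod.snd_add, Prod.snd_sub])

include hag in
/-- Reading corresponding cells inside the box of agreement. [folklore] -/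
theorem apply_eq_of_agree (e : RC z) (e' : RC z') (he : e'.1 = e.1 - c.1 + c'.1) (d₁ d₂ : ℤ)
    (h1 : |e.1.1 + d₁ - c.1.1| ≤ R) (h2 : |e.1.2 + d₂ - c.1.2| ≤ R) :
    z (e.1.1 + d₁, e.1.2 + d₂) = z' (e'.1.1 + d₁, e'.1.2 + d₂) := by
  rw [hag (e.1.1 + d₁, e.1.2 + d₂) h1 h2, he]
  congr 1
  exact Prod.ext (by simp only [Prod.fst_add, Prod.fst_sub]; ring)
    (by simp only [Prod.snd_add, Prod.snd_sub]; ring)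

include hag in
/-- Going `m` curves up from `c` and from `c'` leads to corresponding cells, at most `2m` rows
higher, as long as `2m + 1 ≤ R`. [cite: GangloffSablik2021, §5.4.2 (arXiv numbering)] -/
theorem nxtPerm_pow_agree (m : ℕ) (hm : 2 * (m : ℤ) + 1 ≤ R) :
    ((nxtPerm hz' ^ m) c').1 = ((nxtPerm hz ^ m) c).1 - c.1 + c'.1 ∧
      ((nxtPerm hz ^ m) c).1.1 = c.1.1 ∧
      c.1.2 ≤ ((nxtPerm hz ^ m) c).1.2 ∧ ((nxtPerm hz ^ m) c).1.2 ≤ c.1.2 + 2 * m := by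
  induction m with
  | zero => simp
  | succ m ih =>
    obtain ⟨h1, h2, h3, h4⟩ := ih (by push_cast at hm; linarith)
    rw [pow_succ', Equiv.Perm.mul_apply, pow_succ', Equiv.Perm.mul_apply, nxtPerm_apply,
      nxtPerm_apply]
    set e : RC z := (nxtPerm hz ^ m) c with he
    set e' : RC z' := (nxtPerm hz' ^ m) c' with he'
    push_cast at hm ⊢
    have hzz := apply_eq_of_agree c c' R hag e e' h1 0 1
      (by rw [add_zero, h2, sub_self, abs_zero]; linarith)
      (by rw [abs_le]; constructor <;> linarith)
    rw [add_zero, add_zero] at hzz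
    refine ⟨nxtFun_agree hz hz' c c' e e' h1 hzz, (nxtFun_col hz e).trans h2, ?_, ?_⟩ <;>
      rcases nxtFun_row hz e with h | h <;> linarith

include hag in
/-- Going `m` curves down from `c` and from `c'` leads to corresponding cells, at most `2m` rows
lower, as long as `2m + 1 ≤ R`. [cite: GangloffSablik2021, §5.4.2 (arXiv numbering)] -/
theorem nxtPerm_inv_pow_agree (m : ℕ) (hm : 2 * (m : ℤ) + 1 ≤ R) :
    (((nxtPerm hz')⁻¹ ^ m) c').1 = (((nxtPerm hz)⁻¹ ^ m) c).1 - c.1 + c'.1 ∧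
      (((nxtPerm hz)⁻¹ ^ m) c).1.1 = c.1.1 ∧
      c.1.2 - 2 * m ≤ (((nxtPerm hz)⁻¹ ^ m) c).1.2 ∧ (((nxtPerm hz)⁻¹ ^ m) c).1.2 ≤ c.1.2 := by
  induction m with
  | zero => simp
  | succ m ih =>
    obtain ⟨h1, h2, h3, h4⟩ := ih (by push_cast at hm; linarith)
    rw [pow_succ', Equiv.Perm.mul_apply, pow_succ', Equiv.Perm.mul_apply, nxtPerm_inv_apply,
      nxtPerm_inv_apply]
    set e : RC z := ((nxtPerm hz)⁻¹ ^ m) c with he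
    set e' : RC z' := ((nxtPerm hz')⁻¹ ^ m) c' with he'
    push_cast at hm ⊢
    have hzz := apply_eq_of_agree c c' R hag e e' h1 0 (-1)
      (by rw [add_zero, h2, sub_self, abs_zero]; linarith)
      (by rw [abs_le]; constructor <;> linarith)
    rw [add_zero, add_zero, ← sub_eq_add_neg, ← sub_eq_add_neg] at hzz
    refine ⟨prvFun_agree hz hz' c c' e e' h1 hzz, (prvFun_col hz e).trans h2, ?_, ?_⟩ <;>
      rcases prvFun_row hz e with h | h <;> linarith

include hag in
/-- Going `b` curves (up or down) from `c` and from `c'` leads to corresponding cells within `2|b|`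
rows, as long as `2|b| + 1 ≤ R`. [cite: GangloffSablik2021, §5.4.2 (arXiv numbering)] -/
theorem nxtPerm_zpow_agree (b : ℤ) (hb : 2 * |b| + 1 ≤ R) :
    ((nxtPerm hz' ^ b) c').1 = ((nxtPerm hz ^ b) c).1 - c.1 + c'.1 ∧
      ((nxtPerm hz ^ b) c).1.1 = c.1.1 ∧
      c.1.2 - 2 * |b| ≤ ((nxtPerm hz ^ b) c).1.2 ∧ ((nxtPerm hz ^ b) c).1.2 ≤ c.1.2 + 2 * |b| := by
  obtain ⟨m, rfl | rfl⟩ := Int.eq_nat_or_neg b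
  · rw [Nat.abs_cast] at hb ⊢
    obtain ⟨h1, h2, h3, h4⟩ := nxtPerm_pow_agree hz hz' c c' R hag m hb
    rw [zpow_natCast, zpow_natCast]
    exact ⟨h1, h2, by linarith, h4⟩
  · rw [abs_neg, Nat.abs_cast] at hb ⊢
    obtain ⟨h1, h2, h3, h4⟩ := nxtPerm_inv_pow_agree hz hz' c c' R hag m hb
    rw [zpow_neg, zpow_natCast, zpow_neg, zpow_natCast, ← inv_pow, ← inv_pow]
    exact ⟨h1, h2, h3, by linarith⟩

include hag in
/-- Following the curves `m` columns to the right from corresponding cells `e₀`, `e₀'` of the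
columns of `c`, `c'`, within `B` rows of them, leads to corresponding cells, as long as the cells
read stay in the box: `m + 1 ≤ R` and `B + m ≤ R`. [cite: GangloffSablik2021, §5.4.2 (arXiv numbering)] -/
theorem succPerm_pow_agree (e₀ : RC z) (e₀' : RC z') (h0 : e₀'.1 = e₀.1 - c.1 + c'.1) (B : ℤ)
    (hcol : e₀.1.1 = c.1.1) (hlo : c.1.2 - B ≤ e₀.1.2) (hhi : e₀.1.2 ≤ c.1.2 + B)
    (m : ℕ) (hm : (m : ℤ) + 1 ≤ R) (hBR : B + m ≤ R) :
    ((succPerm hz' ^ m) e₀').1 = ((succPerm hz ^ m) e₀).1 - c.1 + c'.1 ∧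
      ((succPerm hz ^ m) e₀).1.1 = c.1.1 + m ∧
      c.1.2 - B - m ≤ ((succPerm hz ^ m) e₀).1.2 ∧ ((succPerm hz ^ m) e₀).1.2 ≤ c.1.2 + B := by
  induction m with
  | zero =>
    simp only [pow_zero, Equiv.Perm.coe_one, id_eq, Nat.cast_zero, add_zero, sub_zero]
    exact ⟨h0, hcol, hlo, hhi⟩
  | succ m ih =>
    obtain ⟨h1, h2, h3, h4⟩ := ih (by push_cast at hm; linarith) (by push_cast at hBR; linarith)
    rw [pow_succ', Equiv.Perm.mul_apply, pow_succ', Equiv.Perm.mul_apply, succPerm_apply,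
      succPerm_apply]
    set e : RC z := (succPerm hz ^ m) e₀ with he
    set e' : RC z' := (succPerm hz' ^ m) e₀' with he'
    push_cast at hm hBR ⊢
    have hzz := apply_eq_of_agree c c' R hag e e' h1 1 0
      (by rw [h2, abs_le]; constructor <;> linarith)
      (by rw [add_zero, abs_le]; constructor <;> linarith)
    rw [add_zero, add_zero] at hzz
    refine ⟨succFun_agree hz hz' c c' e e' h1 hzz, by rw [succFun_col hz, h2]; ring, ?_, ?_⟩ <;>
      rcases succFun_row hz e with h | h <;> linarith

include hag in
/-- Following the curves `m` columns to the left, likewise. [cite: GangloffSablik2021, §5.4.2 (arXiv numbering)] -/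
theorem succPerm_inv_pow_agree (e₀ : RC z) (e₀' : RC z') (h0 : e₀'.1 = e₀.1 - c.1 + c'.1) (B : ℤ)
    (hcol : e₀.1.1 = c.1.1) (hlo : c.1.2 - B ≤ e₀.1.2) (hhi : e₀.1.2 ≤ c.1.2 + B)
    (m : ℕ) (hm : (m : ℤ) + 1 ≤ R) (hBR : B + m ≤ R) :
    (((succPerm hz')⁻¹ ^ m) e₀').1 = (((succPerm hz)⁻¹ ^ m) e₀).1 - c.1 + c'.1 ∧
      (((succPerm hz)⁻¹ ^ m) e₀).1.1 = c.1.1 - m ∧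
      c.1.2 - B ≤ (((succPerm hz)⁻¹ ^ m) e₀).1.2 ∧ (((succPerm hz)⁻¹ ^ m) e₀).1.2 ≤ c.1.2 + B + m := by
  induction m with
  | zero =>
    simp only [pow_zero, Equiv.Perm.coe_one, id_eq, Nat.cast_zero, add_zero, sub_zero]
    exact ⟨h0, hcol, hlo, hhi⟩
  | succ m ih =>
    obtain ⟨h1, h2, h3, h4⟩ := ih (by push_cast at hm; linarith) (by push_cast at hBR; linarith)
    rw [pow_succ', Equiv.Perm.mul_apply, pow_succ', Equiv.Perm.mul_apply, succPerm_inv_apply,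
      succPerm_inv_apply]
    set e : RC z := ((succPerm hz)⁻¹ ^ m) e₀ with he
    set e' : RC z' := ((succPerm hz')⁻¹ ^ m) e₀' with he'
    push_cast at hm hBR ⊢
    have hzz := apply_eq_of_agree c c' R hag e e' h1 (-1) 0
      (by rw [h2, abs_le]; constructor <;> linarith)
      (by rw [add_zero, abs_le]; constructor <;> linarith)
    rw [add_zero, add_zero, ← sub_eq_add_neg, ← sub_eq_add_neg] at hzz
    refine ⟨predFun_agree hz hz' c c' e e' h1 hzz, by rw [predFun_col hz, h2]; ring, ?_, ?_⟩ <;>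
      rcases predFun_row hz e with h | h <;> linarith

include hag in
/-- **Locality of the curve structure.** If `z`, `z'` obey the rules of `Δ` and agree, up to the
translation taking the `→`-cell `c` to the `→`-cell `c'`, on the box of radius `R` around them,
then following `a` columns and `b` curves from `c` and from `c'` leads to corresponding cells,
provided `|a| + 2|b| + 1 ≤ R`. [cite: GangloffSablik2021, §5.4.2 (arXiv numbering)] -/
theorem curve_agree (a b : ℤ) (hR : |a| + 2 * |b| + 1 ≤ R) :
    ((succPerm hz' ^ a) ((nxtPerm hz' ^ b) c')).1 =
      ((succPerm hz ^ a) ((nxtPerm hz ^ b) c)).1 - c.1 + c'.1 := by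
  have ha0 := abs_nonneg a
  obtain ⟨h1, h2, h3, h4⟩ := nxtPerm_zpow_agree hz hz' c c' R hag b (by linarith)
  obtain ⟨m, rfl | rfl⟩ := Int.eq_nat_or_neg a
  · rw [Nat.abs_cast] at hR
    rw [zpow_natCast, zpow_natCast]
    exact (succPerm_pow_agree hz hz' c c' R hag _ _ h1 (2 * |b|) h2 h3 h4 m (by linarith)
      (by linarith)).1
  · rw [abs_neg, Nat.abs_cast] at hR
    rw [zpow_neg, zpow_natCast, zpow_neg, zpow_natCast, ← inv_pow, ← inv_pow]
    exact (succPerm_inv_pow_agree hz hz' c c' R hag _ _ h1 (2 * |b|) h2 h3 h4 m (by linarith)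
      (by linarith)).1

end Locality

/-! ### `d_A(X)` is of finite type -/

/-- The pseudo-projection of a configuration obeying the rules of `Δ`: read `z` along the
curves. [cite: GangloffSablik2021, §5.4.2 (arXiv numbering)] -/
noncomputable def proj (hz : IsDelta z) : ℤ × ℤ → A :=
  fun v => Option.get (z (curvePt hz v.1 v.2).1) (Option.ne_none_iff_isSome.mp (curvePt hz v.1 v.2).2)

/-- `proj hz` is the pseudo-projection of `z`. [cite: GangloffSablik2021, §5.4.2 (arXiv numbering)] -/
theorem isProj_proj (hz : IsDelta z) : IsProj hz (proj hz) := fun i k => by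
  unfold proj
  rw [Option.some_get]

/-- A configuration obeying the rules of `Δ` is in `d_A(X)` iff its pseudo-projection is in `X`.
[cite: GangloffSablik2021, §5.4.2 (arXiv numbering)] -/
theorem mem_distortion_iff (hz : IsDelta z) (X : Set (ℤ × ℤ → A)) :
    z ∈ distortion X ↔ proj hz ∈ X := by
  constructor
  · rintro ⟨hz', x, hx, hproj⟩
    rwa [(isProj_proj hz).unique hz hproj]
  · exact fun h => ⟨hz, proj hz, h, isProj_proj hz⟩

/-- **`d_A` maps subshifts of finite type to subshifts of finite type** (Gangloff–Sablik §5.4.2: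
"Because the gap between two contiguous curves is bounded, `d_A(X)` is defined by a finite set of
forbidden patterns. Then this is a SFT"). With `X = X(Ω, P)`, `Ω ⊆ [-D, D]²`: `d_A(X)` is the set
of configurations all of whose `[-R, R]²`-windows, `R = 3D + 1`, occur in members of `d_A(X)`
(locality of the rules of `Δ` and of the curve structure, `curve_agree`).
[cite: GangloffSablik2021, §5.4.2 (arXiv numbering)] -/
theorem isSFT_distortion {X : Set (ℤ × ℤ → A)} (hX : IsSFT X) : IsSFT (distortion X) := by
  classical
  obtain ⟨Ω, P, rfl⟩ := hX
  -- a bound `D` on the window and the radius `R`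
  set D : ℤ := ∑ i ∈ Ω, (|i.1| + |i.2|) with hD
  have hDi : ∀ i ∈ Ω, |i.1| ≤ D ∧ |i.2| ≤ D := by
    intro i hi
    have h1 : |i.1| + |i.2| ≤ D :=
      Finset.single_le_sum (f := fun i : ℤ × ℤ => |i.1| + |i.2|) (fun j _ => by positivity) hi
    have h2 := abs_nonneg i.2
    have h3 := abs_nonneg i.1
    exact ⟨by linarith, by linarith⟩
  have hD0 : 0 ≤ D := Finset.sum_nonneg fun i _ => by positivity
  set R : ℤ := 3 * D + 1 with hR
  let Ω' : Finset (ℤ × ℤ) := Finset.Icc (-R) R ×ˢ Finset.Icc (-R) R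
  have hmemΩ' : ∀ d : ℤ × ℤ, |d.1| ≤ R → |d.2| ≤ R → d ∈ Ω' := fun d h1 h2 => by
    rw [abs_le] at h1 h2
    simp only [Ω', Finset.mem_product, Finset.mem_Icc]
    exact ⟨⟨h1.1, h1.2⟩, ⟨h2.1, h2.2⟩⟩
  let X : Set (ℤ × ℤ → A) := {x | ∀ v : ℤ × ℤ, (fun i : Ω => shift v x i) ∈ P}
  let P' : Set (Ω' → Option A) :=
    {q | ∃ z' ∈ distortion X, ∃ t : ℤ × ℤ, ∀ d : Ω', q d = z' (t + d)}
  refine ⟨Ω', P', Set.ext fun z => ⟨fun hz v => ⟨z, hz, v, fun d => rfl⟩, fun hloc => ?_⟩⟩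
  -- a configuration all of whose `R`-boxes occur in `d_A(X)` is in `d_A(X)`
  have hbox : ∀ v : ℤ × ℤ, ∃ z' ∈ distortion X, ∃ t : ℤ × ℤ,
      ∀ d : ℤ × ℤ, |d.1| ≤ R → |d.2| ≤ R → z (v + d) = z' (t + d) := by
    intro v
    obtain ⟨z', hz', t, ht⟩ := hloc v
    exact ⟨z', hz', t, fun d h1 h2 => ht ⟨d, hmemΩ' d h1 h2⟩⟩
  have hR1 : (1 : ℤ) ≤ R := by linarith
  have h00 : |(0 : ℤ)| ≤ R := by rw [abs_zero]; linarith
  have h11 : |(1 : ℤ)| ≤ R := by rw [abs_one]; exact hR1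
  have h11' : |(-1 : ℤ)| ≤ R := by rw [abs_neg, abs_one]; exact hR1
  -- (1) `z` obeys the rules of `Δ`, which involve adjacent cells only
  have hz : IsDelta z := by
    refine ⟨fun i j h => ?_, fun i j h h' => ?_, fun i j h h' => ?_⟩
    · obtain ⟨z', ⟨hz', -⟩, t, ht⟩ := hbox (i, j)
      have e0 := ht (0, 0) h00 h00
      have e1 := ht (0, -1) h00 h11'
      simp only [Prod.mk_add_mk, add_zero] at e0 e1
      rw [← sub_eq_add_neg] at e1
      rw [e1]
      obtain ⟨t₁, t₂⟩ := t
      simp only [Prod.mk_add_mk, add_zero, ← sub_eq_add_neg] at e0 e1 ⊢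
      exact hz'.below_ne_none t₁ t₂ (e0 ▸ h)
    · obtain ⟨z', ⟨hz', -⟩, t, ht⟩ := hbox (i, j)
      have e0 := ht (0, 0) h00 h00
      have e1 := ht (1, 0) h11 h00
      have e2 := ht (0, -1) h00 h11'
      obtain ⟨t₁, t₂⟩ := t
      simp only [Prod.mk_add_mk, add_zero, ← sub_eq_add_neg] at e0 e1 e2 ⊢
      rw [e2]
      exact hz'.left_rule t₁ t₂ (e1 ▸ h) (e0 ▸ h')
    · obtain ⟨z', ⟨hz', -⟩, t, ht⟩ := hbox (i, j)
      have e0 := ht (0, 0) h00 h00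
      have e1 := ht (1, 0) h11 h00
      have e2 := ht (1, 1) h11 h11
      obtain ⟨t₁, t₂⟩ := t
      simp only [Prod.mk_add_mk, add_zero] at e0 e1 e2 ⊢
      rw [e2]
      exact hz'.right_rule t₁ t₂ (e0 ▸ h) (e1 ▸ h')
  -- (2) the pseudo-projection of `z` is in `X`: each of its windows is a window of the
  -- pseudo-projection of the member of `d_A(X)` in which the box around the curve point occurs
  refine (mem_distortion_iff hz X).mpr fun v => ?_
  obtain ⟨i, k⟩ := v
  set c : RC z := curvePt hz i k with hc
  obtain ⟨z', ⟨hz', x', hx', hproj'⟩, t, ht⟩ := hbox c.1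
  have htc : z' t ≠ none := by
    have := ht (0, 0) h00 h00
    simp only [Prod.mk_zero_zero, add_zero] at this
    rw [← this]
    exact c.2
  set c' : RC z' := ⟨t, htc⟩ with hc'
  obtain ⟨k', hk'⟩ := exists_curvePt_eq hz' c'
  -- agreement in the form used by `curve_agree`
  have hag : ∀ p : ℤ × ℤ, |p.1 - c.1.1| ≤ R → |p.2 - c.1.2| ≤ R → z p = z' (p - c.1 + c'.1) := by
    intro p h1 h2
    have := ht (p - c.1) h1 h2
    rw [add_sub_cancel] at this
    rw [this, add_comm]
  -- the window of `proj hz` at `(i, k)` is the window of `x'` at `(t.1, k')`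
  have key : (fun w : Ω => shift ((i, k) : ℤ × ℤ) (proj hz) w) =
      fun w : Ω => shift ((c'.1.1, k') : ℤ × ℤ) x' w := by
    funext w
    obtain ⟨hw1, hw2⟩ := hDi w w.2
    simp only [shift_apply]
    have e1 : ((i, k) : ℤ × ℤ) + (w : ℤ × ℤ) = (i + (w : ℤ × ℤ).1, k + (w : ℤ × ℤ).2) := rfl
    have e2 : ((c'.1.1, k') : ℤ × ℤ) + (w : ℤ × ℤ) = (c'.1.1 + (w : ℤ × ℤ).1, k' + (w : ℤ × ℤ).2) :=
      rfl
    rw [e1, e2]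
    -- both sides read corresponding cells
    have hcz : curvePt hz (i + (w : ℤ × ℤ).1) (k + (w : ℤ × ℤ).2) =
        (succPerm hz ^ (w : ℤ × ℤ).1) ((nxtPerm hz ^ (w : ℤ × ℤ).2) c) := by
      rw [add_comm i, curvePt_add_left, curvePt_add_right]
    have hcz' : curvePt hz' (c'.1.1 + (w : ℤ × ℤ).1) (k' + (w : ℤ × ℤ).2) =
        (succPerm hz' ^ (w : ℤ × ℤ).1) ((nxtPerm hz' ^ (w : ℤ × ℤ).2) c') := by
      rw [add_comm c'.1.1, curvePt_add_left, curvePt_add_right, hk']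
    have hagree := curve_agree hz hz' c c' R hag (w : ℤ × ℤ).1 (w : ℤ × ℤ).2 (by linarith)
    have h1 := isProj_proj hz (i + (w : ℤ × ℤ).1) (k + (w : ℤ × ℤ).2)
    have h2 := hproj' (c'.1.1 + (w : ℤ × ℤ).1) (k' + (w : ℤ × ℤ).2)
    rw [hcz] at h1
    rw [hcz', hagree, ← hag _ ?_ ?_] at h2
    · exact Option.some_injective _ (h1.symm.trans h2)
    · -- the cell read lies in the box: columns
      rw [succPerm_zpow_col, nxtPerm_zpow_col, add_sub_cancel_left]
      linarith [abs_nonneg (w : ℤ × ℤ).2]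
    · -- rows
      obtain ⟨h1c, h2c, h3, h4⟩ :=
        nxtPerm_zpow_agree hz hz' c c' R hag (w : ℤ × ℤ).2 (by linarith)
      obtain ⟨m, hm | hm⟩ := Int.eq_nat_or_neg (w : ℤ × ℤ).1
      · rw [hm, Nat.abs_cast] at hw1
        obtain ⟨-, -, h5, h6⟩ := succPerm_pow_agree hz hz' c c' R hag _ _ h1c
          (2 * |(w : ℤ × ℤ).2|) h2c h3 h4 m (by linarith) (by linarith)
        rw [hm, zpow_natCast, abs_le]
        constructor <;> linarith
      · rw [hm, abs_neg, Nat.abs_cast] at hw1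
        obtain ⟨-, -, h5, h6⟩ := succPerm_inv_pow_agree hz hz' c c' R hag _ _ h1c
          (2 * |(w : ℤ × ℤ).2|) h2c h3 h4 m (by linarith) (by linarith)
        rw [hm, zpow_neg, zpow_natCast, ← inv_pow, abs_le]
        constructor <;> linarith
  show (fun w : Ω => shift ((i, k) : ℤ × ℤ) (proj hz) w) ∈ P
  rw [key]
  exact hx' _

end Literature.Dynamics.SymbolicDynamics.Distortion
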